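import Mathlib
import Summits.Ventures.HodgeRepro.Tier4.Common.AdelicDefs
import Summits.Ventures.HodgeRepro.Tier4.Common.AdelicPlaces
import Summits.Ventures.HodgeRepro.Tier4.Common.AdicResidue
import Summits.Ventures.HodgeRepro.Tier4.Line1.SecondCountableGA
import Summits.Ventures.HodgeRepro.Tier4.Line1.AdeleCocompactAssembly
import Summits.Ventures.HodgeRepro.Tier4.Line1.HaarModulus
import Summits.Ventures.HodgeRepro.Tier4.Line1.ModulusVecMul
import Summits.Ventures.HodgeRepro.Tier4.Line1.ModulusEmbed
import Summits.Ventures.HodgeRepro.Tier4.Line1.AdelicSingle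

/-!
# Tier4/Line1/AdelicModulusBase — the modulus formula on `𝔸_k^ι` for matrices that are trivial at infinity and
integral at every finite place (the base case of the place induction)

Blind re-derivation cell `pub-hodge-repro`, Tier 4 (README §9–§10), seat t4-L2-p2 (gen 2), wall-breaker on the
cocompactness rung C5 of LINE L1 («the adelic modulus», t4-L1-p5's `I1c-rungs-sig.lean`).  Target tree path
`lean/Summits/Ventures/HodgeRepro/Tier4/Line1/AdelicModulusBase.lean`.  Imports: typer-2's `Common/AdelicDefs`,
`Common/AdelicPlaces` (the component maps), `Common/AdicResidue` (local compactness of `𝔸_k`), t4-L1-p5's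
`Line1/SecondCountableGA` (`secondCountable_adeleRing`) and `Line1/AdeleCocompactAssembly`
(`isCompact_integralFiniteAdeles`), and this seat's `HaarModulus`, `ModulusVecMul`, `ModulusEmbed`, `AdelicSingle`.

`𝔸_k` is a locally compact second countable topological ring (recorded here as instances from the landed theorems), so
`HasDetModulus μ ν M` («the Haar modulus of `x ↦ x ᵥ* M` on `𝔸_k^ι` is the modulus of multiplication by `det M`»)
makes sense for `M ∈ GL_ι(𝔸_k)`.  An invertible `M` is **trivial at the infinite place `w`** if its `w`-component is
`1`, **integral at the finite place `v`** if the `v`-components of `M` and of `M⁻¹` have entries in `𝓞_v`; every `M`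
is integral at all but finitely many finite places.  If `M` is trivial at every infinite place and integral at every
finite place, then `x ↦ x ᵥ* M` maps the compact neighbourhood `(K_∞ × ∏_v 𝓞_v)^ι` of `0` onto itself and `det M`
maps `K_∞ × ∏_v 𝓞_v` onto itself, so both moduli are `1`: `hasDetModulus_of_trivial_of_integral`.

Nothing here asserts anything about the Hodge conjecture for CM abelian varieties, which is NOT proved (HC_CM is NOT
proved by anyone in this repository).
-/

set_option autoImplicit false

noncomputable section

namespace Summit.Ventures.HodgeRepro.Tier4.Line1

open NumberField IsDedekindDomain HeightOneSpectrum MeasureTheory Measure Topology Matrix Common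
open scoped NumberField RestrictedProduct ENNReal NNReal

section Instances

variable (k : Type) [Field k] [NumberField k]

/-- `𝔸_k` is second countable (t4-L1-p5's `secondCountable_adeleRing`), as an instance. -/
instance instSecondCountableTopologyAd : SecondCountableTopology (Ad k) := secondCountable_adeleRing k

/-- `𝔸_k` is locally compact (`Common.locallyCompactSpace_adeleRing`), as an instance. -/
instance instLocallyCompactSpaceAd : LocallyCompactSpace (Ad k) := locallyCompactSpace_adeleRing k

end Instances

section Goodness

variable {k : Type} [Field k] [NumberField k] {ι : Type*} [Fintype ι] [DecidableEq ι]

/-- **`M` is trivial at the infinite place `w`**: its `w`-component is the identity. -/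
def TrivialAtInf (w : InfinitePlace k) (M : (Matrix ι ι (Ad k))ˣ) : Prop := evUnits (adComponentInf k w) M = 1

/-- **`M` is integral at the finite place `v`**: the entries of the `v`-components of `M` and of `M⁻¹` lie in `𝓞_v`. -/
def IntegralAtFin (v : HeightOneSpectrum (𝓞 k)) (M : (Matrix ι ι (Ad k))ˣ) : Prop :=
  (∀ i j, ((evUnits (adComponentFin k v) M : (Matrix ι ι (v.adicCompletion k))ˣ) : Matrix ι ι (v.adicCompletion k)) i j
      ∈ v.adicCompletionIntegers k) ∧
  (∀ i j, ((evUnits (adComponentFin k v) M⁻¹ : (Matrix ι ι (v.adicCompletion k))ˣ) : Matrix ι ι (v.adicCompletion k)) i j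
      ∈ v.adicCompletionIntegers k)

/-- `1` is trivial at every infinite place. -/
theorem trivialAtInf_one (w : InfinitePlace k) : TrivialAtInf w (1 : (Matrix ι ι (Ad k))ˣ) := map_one _

/-- Triviality at `w` is preserved by inverses. -/
theorem TrivialAtInf.inv {w : InfinitePlace k} {M : (Matrix ι ι (Ad k))ˣ} (h : TrivialAtInf w M) :
    TrivialAtInf w M⁻¹ := by
  unfold TrivialAtInf at *
  rw [map_inv, h, inv_one]

/-- Integrality at `v` is preserved by inverses. -/
theorem IntegralAtFin.inv {v : HeightOneSpectrum (𝓞 k)} {M : (Matrix ι ι (Ad k))ˣ} (h : IntegralAtFin v M) :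
    IntegralAtFin v M⁻¹ := by
  refine ⟨h.2, ?_⟩
  rw [inv_inv]
  exact h.1

/-- The entries of the `v`-component of an adelic matrix: `(M.map (adComponentFin k v)) i j = (M i j).2 v`. -/
theorem coe_evUnits_adComponentFin_apply (v : HeightOneSpectrum (𝓞 k)) (M : (Matrix ι ι (Ad k))ˣ) (i j : ι) :
    ((evUnits (adComponentFin k v) M : (Matrix ι ι (v.adicCompletion k))ˣ) : Matrix ι ι (v.adicCompletion k)) i j =
      ((M : Matrix ι ι (Ad k)) i j).2 v := rfl

/-- **Every invertible adelic matrix is integral at all but finitely many finite places.** -/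
theorem exists_finset_integralAtFin (M : (Matrix ι ι (Ad k))ˣ) :
    ∃ T : Finset (HeightOneSpectrum (𝓞 k)), ∀ v ∉ T, IntegralAtFin v M := by
  classical
  have hfin : ∀ a : Ad k, {v : HeightOneSpectrum (𝓞 k) | a.2 v ∉ v.adicCompletionIntegers k}.Finite :=
    fun a => Filter.eventually_cofinite.1 a.2.2
  let S : Set (HeightOneSpectrum (𝓞 k)) :=
    (⋃ i : ι, ⋃ j : ι, {v | ((M : Matrix ι ι (Ad k)) i j).2 v ∉ v.adicCompletionIntegers k}) ∪
      (⋃ i : ι, ⋃ j : ι, {v | (((M⁻¹ : (Matrix ι ι (Ad k))ˣ) : Matrix ι ι (Ad k)) i j).2 v ∉ v.adicCompletionIntegers k})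
  have hS : S.Finite :=
    (Set.finite_iUnion fun i => Set.finite_iUnion fun j => hfin _).union
      (Set.finite_iUnion fun i => Set.finite_iUnion fun j => hfin _)
  refine ⟨hS.toFinset, fun v hv => ?_⟩
  rw [Set.Finite.mem_toFinset] at hv
  simp only [S, Set.mem_union, Set.mem_iUnion, Set.mem_setOf_eq, not_or, not_exists, not_not] at hv
  exact ⟨fun i j => hv.1 i j, fun i j => hv.2 i j⟩

end Goodness

section Base

variable {k : Type} [Field k] [NumberField k] {ι : Type*} [Fintype ι] [DecidableEq ι]

/-- The projection of `𝔸_k` to its archimedean part, typed on `Ad k`. -/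
def adFst (k : Type) [Field k] [NumberField k] : Ad k →+* InfiniteAdeleRing k :=
  RingHom.fst (InfiniteAdeleRing k) (FiniteAdeleRing (𝓞 k) k)

/-- `adFst x = x.1`. -/
@[simp]
theorem adFst_apply (x : Ad k) : adFst k x = x.1 := rfl

/-- The `∞`-component of a matrix trivial at every infinite place is the identity. -/
theorem map_adFst_eq_one_of_trivial (M : (Matrix ι ι (Ad k))ˣ) (hinf : ∀ w, TrivialAtInf w M) :
    (M : Matrix ι ι (Ad k)).map (adFst k) = 1 := by
  ext i j
  funext w
  have h := congrArg (fun N : (Matrix ι ι w.Completion)ˣ => (N : Matrix ι ι w.Completion) i j) (hinf w)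
  simp only [coe_evUnits, Matrix.map_apply, Units.val_one] at h
  change ((M : Matrix ι ι (Ad k)) i j).1 w = (1 : Matrix ι ι (InfiniteAdeleRing k)) i j w
  rw [Matrix.one_apply] at h ⊢
  by_cases hij : i = j
  · rw [if_pos hij] at h ⊢
    exact h
  · rw [if_neg hij] at h ⊢
    exact h

/-- The determinant of a matrix with entries in a subring lies in the subring. -/
theorem det_mem_of_forall_mem {F : Type*} [CommRing F] {S : Type*} [SetLike S F] [SubringClass S F] (s : S)
    (N : Matrix ι ι F) (h : ∀ i j, N i j ∈ s) : det N ∈ s := by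
  let N' : Matrix ι ι s := fun i j => ⟨N i j, h i j⟩
  have hN : N = (SubringClass.subtype s).mapMatrix N' := by
    ext i j
    rfl
  rw [hN, ← RingHom.map_det]
  exact Subtype.mem _

/-- The determinant of a matrix trivial at infinity and integral at every finite place is trivial at infinity and
integral at every finite place. -/
theorem det_trivial_integral (M : (Matrix ι ι (Ad k))ˣ) (hinf : ∀ w, TrivialAtInf w M)
    (hfin : ∀ v, IntegralAtFin v M) :
    (det (M : Matrix ι ι (Ad k))).1 = 1 ∧
      ∀ v : HeightOneSpectrum (𝓞 k), (det (M : Matrix ι ι (Ad k))).2 v ∈ v.adicCompletionIntegers k := by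
  constructor
  · have h := RingHom.map_det (adFst k) (M : Matrix ι ι (Ad k))
    rw [RingHom.mapMatrix_apply, map_adFst_eq_one_of_trivial M hinf, det_one] at h
    exact h
  · intro v
    have h := RingHom.map_det (adComponentFin k v) (M : Matrix ι ι (Ad k))
    rw [RingHom.mapMatrix_apply] at h
    change adComponentFin k v (det (M : Matrix ι ι (Ad k))) ∈ _
    rw [h]
    exact det_mem_of_forall_mem _ _ fun i j => (hfin v).1 i j

/-- The compact neighbourhood `K₁ = K_∞ ×ˢ ∏_v 𝓞_v` of `0` in `𝔸_k`, for a compact neighbourhood `K_∞` of `0` in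
`𝔸_{k,∞}`. -/
def baseNhd (Kinf : Set (InfiniteAdeleRing k)) : Set (Ad k) :=
  Kinf ×ˢ {a : FiniteAdeleRing (𝓞 k) k | ∀ v : HeightOneSpectrum (𝓞 k), a v ∈ v.adicCompletionIntegers k}

/-- Membership in `baseNhd`. -/
theorem mem_baseNhd (Kinf : Set (InfiniteAdeleRing k)) (x : Ad k) :
    x ∈ baseNhd Kinf ↔ x.1 ∈ Kinf ∧ ∀ v : HeightOneSpectrum (𝓞 k), x.2 v ∈ v.adicCompletionIntegers k :=
  Set.mem_prod

/-- `baseNhd Kinf` is compact when `Kinf` is. -/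
theorem isCompact_baseNhd {Kinf : Set (InfiniteAdeleRing k)} (hK : IsCompact Kinf) : IsCompact (baseNhd Kinf) :=
  hK.prod (isCompact_integralFiniteAdeles k)

/-- `baseNhd Kinf` is a neighbourhood of `0` when `Kinf` is. -/
theorem baseNhd_mem_nhds {Kinf : Set (InfiniteAdeleRing k)} (hK : Kinf ∈ 𝓝 (0 : InfiniteAdeleRing k)) :
    baseNhd Kinf ∈ 𝓝 (0 : Ad k) := by
  have hopen : IsOpen {a : FiniteAdeleRing (𝓞 k) k |
      ∀ v : HeightOneSpectrum (𝓞 k), a v ∈ v.adicCompletionIntegers k} :=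
    RestrictedProduct.isOpen_forall_mem fun v => Valued.isOpen_valuationSubring (v.adicCompletion k)
  have h0 : (0 : FiniteAdeleRing (𝓞 k) k) ∈ {a : FiniteAdeleRing (𝓞 k) k |
      ∀ v : HeightOneSpectrum (𝓞 k), a v ∈ v.adicCompletionIntegers k} := fun v => by
    change (0 : v.adicCompletion k) ∈ v.adicCompletionIntegers k
    exact zero_mem _
  exact prod_mem_nhds hK (hopen.mem_nhds h0)

/-- Multiplication by an adele `d` with `d.1 = 1` and integral finite components maps `baseNhd Kinf` into itself. -/
theorem mul_mem_baseNhd {Kinf : Set (InfiniteAdeleRing k)} {d : Ad k} (hd1 : d.1 = 1)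
    (hd2 : ∀ v : HeightOneSpectrum (𝓞 k), d.2 v ∈ v.adicCompletionIntegers k) {a : Ad k} (ha : a ∈ baseNhd Kinf) :
    a * d ∈ baseNhd Kinf := by
  rw [mem_baseNhd] at ha ⊢
  refine ⟨?_, fun v => ?_⟩
  · change a.1 * d.1 ∈ Kinf
    rw [hd1, mul_one]
    exact ha.1
  · change a.2 v * d.2 v ∈ v.adicCompletionIntegers k
    exact mul_mem (ha.2 v) (hd2 v)

/-- Right multiplication by a matrix trivial at infinity and integral at every finite place maps the box
`(baseNhd Kinf)^ι` into itself. -/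
theorem vecMul_mem_pi_baseNhd {Kinf : Set (InfiniteAdeleRing k)} (M : (Matrix ι ι (Ad k))ˣ)
    (hinf : ∀ w, TrivialAtInf w M) (hfin : ∀ v, IntegralAtFin v M) {x : ι → Ad k}
    (hx : x ∈ Set.univ.pi fun _ : ι => baseNhd Kinf) :
    x ᵥ* (M : Matrix ι ι (Ad k)) ∈ Set.univ.pi fun _ : ι => baseNhd Kinf := by
  rw [Set.mem_univ_pi] at hx ⊢
  intro l
  rw [mem_baseNhd]
  refine ⟨?_, fun v => ?_⟩
  · have h := RingHom.map_vecMul (adFst k) (M : Matrix ι ι (Ad k)) x l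
    change adFst k ((x ᵥ* (M : Matrix ι ι (Ad k))) l) ∈ Kinf
    rw [h, map_adFst_eq_one_of_trivial M hinf, vecMul_one]
    exact ((mem_baseNhd Kinf (x l)).1 (hx l)).1
  · have h := RingHom.map_vecMul (adComponentFin k v) (M : Matrix ι ι (Ad k)) x l
    change adComponentFin k v ((x ᵥ* (M : Matrix ι ι (Ad k))) l) ∈ v.adicCompletionIntegers k
    rw [h]
    simp only [vecMul, dotProduct, Function.comp]
    refine sum_mem fun m _ => mul_mem ?_ ?_
    · exact ((mem_baseNhd Kinf (x m)).1 (hx m)).2 v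
    · exact (hfin v).1 m l

variable [MeasurableSpace (Ad k)] [BorelSpace (Ad k)] (ν : Measure (Ad k)) [ν.IsAddHaarMeasure]
  (μ : Measure (ι → Ad k)) [μ.IsAddHaarMeasure]

/-- **The base case**: a matrix trivial at infinity and integral at every finite place has the determinant modulus
(both moduli are `1`). -/
theorem hasDetModulus_of_trivial_of_integral (M : (Matrix ι ι (Ad k))ˣ) (hinf : ∀ w, TrivialAtInf w M)
    (hfin : ∀ v, IntegralAtFin v M) : HasDetModulus μ ν M := by
  obtain ⟨Kinf, hKc, hKn⟩ := exists_compact_mem_nhds (0 : InfiniteAdeleRing k)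
  have hinf' : ∀ w, TrivialAtInf w M⁻¹ := fun w => (hinf w).inv
  have hfin' : ∀ v, IntegralAtFin v M⁻¹ := fun v => (hfin v).inv
  unfold HasDetModulus
  -- the modulus of `x ↦ x ᵥ* M` is `1`
  have h1 : modulus μ (vecMulEquiv M) = 1 := by
    refine modulus_eq_one_of_preimage_eq μ _ (K := Set.univ.pi fun _ : ι => baseNhd Kinf) ?_ ?_ ?_
    · ext x
      constructor
      · intro hx
        have := vecMul_mem_pi_baseNhd M⁻¹ hinf' hfin' hx
        rwa [vecMulEquiv_apply, vecMul_vecMul, Units.mul_inv, vecMul_one] at this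
      · intro hx
        exact vecMul_mem_pi_baseNhd M hinf hfin hx
    · have hn : (Set.univ.pi fun _ : ι => baseNhd Kinf) ∈ 𝓝 (0 : ι → Ad k) :=
        set_pi_mem_nhds Set.finite_univ fun _ _ => baseNhd_mem_nhds hKn
      exact (measure_pos_of_nonempty_interior μ ⟨0, mem_interior_iff_mem_nhds.2 hn⟩).ne'
    · exact (isCompact_univ_pi fun _ => isCompact_baseNhd hKc).measure_lt_top.ne
  -- the modulus of multiplication by `det M` is `1`
  have h2 : modUnit ν (detUnit M) = 1 := by
    obtain ⟨hd1, hd2⟩ := det_trivial_integral M hinf hfin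
    obtain ⟨hd1', hd2'⟩ := det_trivial_integral M⁻¹ hinf' hfin'
    refine modulus_eq_one_of_preimage_eq ν _ (K := baseNhd Kinf) ?_ ?_ ?_
    · ext a
      constructor
      · intro ha
        have := mul_mem_baseNhd hd1' hd2' ha
        rw [mulRightEquiv_apply, coe_detUnit, mul_assoc, ← coe_detUnit, ← coe_detUnit, ← Units.val_mul,
          detUnit_inv, mul_inv_cancel, Units.val_one, mul_one] at this
        exact this
      · intro ha
        rw [Set.mem_preimage, mulRightEquiv_apply, coe_detUnit]
        exact mul_mem_baseNhd hd1 hd2 ha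
    · exact (measure_pos_of_nonempty_interior ν ⟨0, mem_interior_iff_mem_nhds.2 (baseNhd_mem_nhds hKn)⟩).ne'
    · exact (isCompact_baseNhd hKc).measure_lt_top.ne
  rw [h1, h2]

end Base

end Summit.Ventures.HodgeRepro.Tier4.Line1

end
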